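import Literature.Computability.Cryptography.LiuPassHeurProgram
import Literature.Computability.Cryptography.YaoInvProgram
import HarnessLib

/-!
# Discharge of the efficiency fact of `LiuPassCondEPPRG.lean` (Liu–Pass, proof of Thm 5.2: the distinguisher is PPT)

`LiuPassCondEPPRG.lean` proves Liu–Pass's Thm 5.2 (FOCS 2020; arXiv:2009.11514, §5.2) down to one
efficiency claim, vendored there (D-0014) as the named fact
`Literature.Computability.Cryptography.liuPassDistRun_polyTime`: for every PPT heuristic `ℋ` the
deterministic core `(⟨1ⁿ, x⟩, r) ↦ [ℋ(x; r) ≥ |x| - 3⌊log₂ n⌋]` (`liuPassDistRun ℋ`) of print's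
distinguisher `𝒜(1ⁿ, x)` ("lets `w ← ℋ(x)` and outputs `1` if `w ≥ m(n) - (3γ/8) log n` and `0`
otherwise"; print states that `𝒜` is PPT without further comment) is polynomial-time computable in
the tree's TM2 sense. This file proves it:

* `lpAdvRun_eval_zero` — the deterministic core `lpAdvRun ℋ γ Q K` of the *padding* distinguisher
  of `LiuPassPadding.lean` specialises, for the zero polynomials `Q = K = 0`, to `liuPassDistRun ℋ`
  (with `ℕ`'s conventions `m / 0 = 0`, `m % 0 = m` and truncated subtraction the selected outer
  length is `0`, so nothing is padded, and all `|r|` coins are handed to `ℋ`);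
* `liuPassDistRun_polyTime_holds : liuPassDistRun_polyTime` — by transport along that equation of
  `lpAdvRun_polyTime_holds` (`LiuPassPaddingProofs.lean`: the stack program `LPD.prog` of
  `LiuPassDistProgram.lean` for the lengths, the integer logarithm and the threshold in unary, one
  call of `ℋ` in the second component, the unary/binary comparison `unLeBinFn`, composed by
  `PolyTimeComputable.comp_holds`);
* the consequences for the S02 assembly of `LiuPassCondEPPRG.lean` with this hypothesis removed:
  `isMildlyHardOnAverage_liuPassKt_of_OWFExist_of_family_fact`,
  `exists_isMildlyHardOnAverage_liuPassKt_of_OWFExist_of_family_fact`, and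
  `OWFExist_iff_isMildlyHardOnAverage_liuPassKt_of_family_fact` — S02 from the §5.3 fact
  `condEPPRG_family_of_OWFExist` **alone**, the other four facts of
  `OWFExist_iff_isMildlyHardOnAverage_liuPassKt_of_facts` being discharged in the tree
  (`liuPassOWF_polyTimeComputable_holds`, `liuPassHeur_isPPT_holds`,
  `weakOWFExist_iff_OWFExist_holds`, and `liuPassDistRun_polyTime_holds` here). The parallel
  development through Thm 5.5 as printed is `LiuPassPaddingProofs.lean` /
  `LiuPassHeurProgram.lean` (`OWFExist_iff_isMildlyHardOnAverage_liuPassKt_of_Yao_h55`).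

## References

* Y. Liu, R. Pass, *On one-way functions and Kolmogorov complexity*, FOCS 2020, 1243–1254;
  arXiv:2009.11514, §5.2, proof of Thm 5.2 ("Based on these observations, we now construct a PPT
  distinguisher `𝒜` breaking `G`"), Thm 3.1, Thm 1.1. doi:10.1109/FOCS46700.2020.00118
* S. Arora, B. Barak, *Computational Complexity: A Modern Approach*, CUP 2009, §1.3, Thm 1.9
  (polynomial time is closed under composition).
-/

namespace Literature.Computability.Cryptography

open _root_.Computability Complexity MetaComplexity

/-! ### The unpadded distinguisher as the case `Q = K = 0` of the padding distinguisher -/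

/-- **Print's distinguisher is the padding distinguisher with trivial parameters.** For the zero
polynomials `Q = K = 0` (any `γ`) the deterministic core `lpAdvRun ℋ γ Q K` of the padding
distinguisher equals `liuPassDistRun ℋ`: on `⟨a, y⟩` with coins `r`, `lpLo γ 0 |a| = 0 - (γ+1) = 0`,
the outer length is `lpOuter = 0 + (|r| - 0) / 0 = 0`, so the pad is `r.take (0 - |a|) = []` and
the sample stays `y`; the coin count handed to `ℋ` is `lpKap = (|r| - 0) % 0 = |r|`, so `ℋ` gets
`r.drop 0 = r`; and `lpTest ℋ |a| y r = [ℋ(y; r) ≥ |y| - 3⌊log₂ |a|⌋]` is `liuPassDistRun ℋ ⟨a, y⟩ r`.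
[Y. Liu, R. Pass, FOCS 2020, proof of Thm 5.2 (the distinguisher `𝒜`)]
[cite: LiuPassFOCS2020, Thm 5.2 (proof)] -/
theorem lpAdvRun_eval_zero (H : RandAlg (List Bool) ℕ) (γ : ℕ) :
    lpAdvRun H γ (fun n => (0 : Polynomial ℕ).eval n) (fun n => (0 : Polynomial ℕ).eval n) =
      liuPassDistRun H := by
  funext z r
  simp [lpAdvRun, liuPassDistRun, lpTest, lpOuter, lpKap, lpLo]

/-- **Discharge of `liuPassDistRun_polyTime`** (Liu–Pass, proof of Thm 5.2: "we now construct a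
PPT distinguisher `𝒜` … `𝒜(1ⁿ, x)` lets `w ← ℋ(x)` and outputs `1` if `w ≥ m(n) - (3γ/8) log n`
and `0` otherwise"). For every PPT heuristic `ℋ` with binary natural-number output, the map
`(⟨1ⁿ, x⟩, r) ↦ [ℋ(x; r) ≥ |x| - 3⌊log₂ n⌋]` is polynomial-time computable in the tree's TM2 sense:
it is the case `Q = K = 0` (`lpAdvRun_eval_zero`) of the padding distinguisher's core, which is
polynomial time by `lpAdvRun_polyTime_holds` (one `boolUnpair`/reassociation, the stack program
`LPD.prog` computing the threshold `|x| - 3⌊log₂ n⌋` in unary, one call of `ℋ` on `⟨x, r⟩` in the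
second component, and the unary/binary comparison, composed by `PolyTimeComputable.comp_holds`).
[Y. Liu, R. Pass, FOCS 2020, proof of Thm 5.2; arXiv:2009.11514, §5.2; S. Arora, B. Barak,
CUP 2009, Thm 1.9] [cite: LiuPassFOCS2020, Thm 5.2 (proof)] -/
theorem liuPassDistRun_polyTime_holds : liuPassDistRun_polyTime := by
  intro H hH
  rw [← lpAdvRun_eval_zero H 0]
  exact lpAdvRun_polyTime_holds H hH 0 0 0

/-! ### Consequences: the efficiency hypothesis removed from the S02 assembly of `LiuPassCondEPPRG.lean` -/

/-- **S02, direction `→`, for every `U` and every polynomial `t(n) ≥ (1+ε)n`, from the §5.3 fact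
alone** (`isMildlyHardOnAverage_liuPassKt_of_OWFExist_of` with the efficiency fact discharged by
`liuPassDistRun_polyTime_holds`). [Y. Liu, R. Pass, FOCS 2020, Thm 3.1 (a) ⇒ (c) and the remark
following it; Thm 5.2] [cite: LiuPassFOCS2020, Thm 3.1 (a)⇒(c) and remark; Thm 5.2] -/
theorem isMildlyHardOnAverage_liuPassKt_of_OWFExist_of_family_fact (h₅ : condEPPRG_family_of_OWFExist)
    (U : UniversalMachine) (t : Polynomial ℕ) {ε : ℝ} (hε : 0 < ε)
    (ht : ∀ n : ℕ, (1 + ε) * n ≤ ((t.eval n : ℕ) : ℝ)) (hO : OWFExist) :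
    IsMildlyHardOnAverage encodeNat (liuPassKt U t) :=
  isMildlyHardOnAverage_liuPassKt_of_OWFExist_of h₅ liuPassDistRun_polyTime_holds U t hε ht hO

/-- **Liu–Pass 2020, Thm 3.1 (a) ⇒ (b) from the §5.3 fact alone**
(`exists_isMildlyHardOnAverage_liuPassKt_of_OWFExist_of` with the efficiency fact discharged).
[Y. Liu, R. Pass, FOCS 2020, Thm 3.1] [cite: LiuPassFOCS2020, Thm 3.1 (a)⇒(b)] -/
theorem exists_isMildlyHardOnAverage_liuPassKt_of_OWFExist_of_family_fact
    (h₅ : condEPPRG_family_of_OWFExist) : exists_isMildlyHardOnAverage_liuPassKt_of_OWFExist :=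
  exists_isMildlyHardOnAverage_liuPassKt_of_OWFExist_of h₅ liuPassDistRun_polyTime_holds

/-- **crypto-foundations.S02 from the §5.3 fact `condEPPRG_family_of_OWFExist` alone**
(`OWFExist_iff_isMildlyHardOnAverage_liuPassKt_of_facts` with its other four facts discharged in the
tree: the two efficiency facts of Thm 4.1 by `liuPassOWF_polyTimeComputable_holds` and
`liuPassHeur_isPPT_holds`, Yao's amplification S05 by `weakOWFExist_iff_OWFExist_holds`, and the
efficiency fact of Thm 5.2 by `liuPassDistRun_polyTime_holds`).
[Y. Liu, R. Pass, FOCS 2020, Thm 1.1, Thm 3.1] [cite: LiuPassFOCS2020, Thm 1.1] -/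
theorem OWFExist_iff_isMildlyHardOnAverage_liuPassKt_of_family_fact
    (h₅ : condEPPRG_family_of_OWFExist) : OWFExist_iff_isMildlyHardOnAverage_liuPassKt :=
  OWFExist_iff_isMildlyHardOnAverage_liuPassKt_of_facts liuPassOWF_polyTimeComputable_holds
    liuPassHeur_isPPT_holds weakOWFExist_iff_OWFExist_holds h₅ liuPassDistRun_polyTime_holds

end Literature.Computability.Cryptography
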